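import Summits.Ventures.Crystal3D.Theorems.StickyWulffConstantCoaxialWallLawCslGrainLedger
import Summits.Ventures.Crystal3D.Theorems.StickyWulffConstantCoaxialWallLawTwinWord
import HarnessLib

/-!
# The CSL grain lemma of the terrace/riser ledger for the TOP grain (by reflection)

HONEST FRAMING. Part of the venture `Summits/Ventures/Crystal3D` (cell `crystal3d-full`), helper
`--supports` the crux `CoaxialWallLaw` (stmt-Ventures-19481, `route-Ventures-StickyWulffConstant`),
REGISTERED line `WallLedgerF` (planner cf-p1 gen 16), stub `stub_coaxialTwoSlabAdhesion`
(terrace/riser slot ledger, RIGID rung, CSL case).  Rung credit only.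

Mirror image of `csl_grain_ledger` (`…CoaxialWallLawCslGrainLedger`, bottom grain) under the
reflection `Mr : (x, y, z) ↦ (x, y, h − z)` of the cell, exactly as `coaxial_grain_ledger_rimLocal_top`
mirrors `coaxial_grain_ledger_rimLocal`: `Mr` maps the grain `M·Λ₀ + c` to `(M∘S)·Λ₀ + Mr c` and the
twin `M·Λ₀⁻ + c` to `(M∘S)·Λ₀⁻ + Mr c` (same shape), preserves rigidity, lateral radii, distances,
contact numbers, horizontal model slots, the face sum and the sine.

**Theorem (`csl_grain_ledger_top`).**  For the top grain `Λ = M·Λ₀ + c` of a rigid CSL twin filling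
(`X ⊆ Λ ∪ Λ'`, `Λ' = M·Λ₀⁻ + c`, complete clamped slab `P = Λ ∩ {[h + R₀, h + 2R₀] × disc ρ} ⊆ X`):
`(2φ + (√6/2)·s) πρ² − 135√2 πρ − 72(R₀+2)(ρ−1) ≤ Σ_{x ∈ X ∩ Λ, x ∉ Λ' ∨ x ∈ P} (12 − deg x) + 24·#{rim balls of P}`.

WHAT THIS IS NOT: the two-grain assembly, the stub; rung F-C1 not moved.
-/

noncomputable section

namespace Summit.Ventures.Crystal3D.Theorems

open Summit.Ventures.Crystal3D Finset
open Literature.MathematicalPhysics.StatisticalMechanics (fccStacking barlowStacking)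
open scoped InnerProductSpace

open scoped Classical in
/-- **The CSL grain lemma (top grain).**  See the module docstring. -/
theorem csl_grain_ledger_top
    (A : EuclideanSpace ℝ (Fin 3) ≃ₗᵢ[ℝ] EuclideanSpace ℝ (Fin 3)) (t : EuclideanSpace ℝ (Fin 3))
    (X P : Finset (EuclideanSpace ℝ (Fin 3))) (R₀ h ρ : ℝ) (hR₀ : 3 ≤ R₀) (hρ : R₀ ≤ ρ)
    (hX : ∀ p ∈ X, ∀ q ∈ X, p ≠ q → 1 ≤ dist p q)
    (hcell : ∀ p ∈ X, -(2 * R₀) ≤ p 2 ∧ p 2 ≤ h + 2 * R₀ ∧ p 0 ^ 2 + p 1 ^ 2 ≤ ρ ^ 2)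
    (hPX : P ⊆ X)
    (hP : ∀ p, p ∈ P ↔ (p ∈ (fun q => A q + t) '' fccStacking 1 (Real.sqrt (2 / 3)) ∧
      h + R₀ ≤ p 2 ∧ p 2 ≤ h + 2 * R₀ ∧ p 0 ^ 2 + p 1 ^ 2 ≤ ρ ^ 2))
    (hrigid : ∀ p ∈ X, p ∈ (fun q => A q + t) '' fccStacking 1 (Real.sqrt (2 / 3)) ∨
      p ∈ (fun q => A q + t) '' barlowStacking 1 (Real.sqrt (2 / 3)) (fun _ : ℤ => (-1 : ℤ))) :
    (2 * (Real.sqrt 2 / 4 * ∑ w ∈ fccSlots, |⟪A w, EuclideanSpace.single (2 : Fin 3) (1 : ℝ)⟫_ℝ|) +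
        Real.sqrt 6 / 2 * Real.sqrt (1 - ⟪A (EuclideanSpace.single (2 : Fin 3) (1 : ℝ)),
          EuclideanSpace.single (2 : Fin 3) (1 : ℝ)⟫_ℝ ^ 2)) * Real.pi * ρ ^ 2 -
        135 * Real.sqrt 2 * Real.pi * ρ - 72 * (R₀ + 2) * (ρ - 1) ≤
      ∑ x ∈ X.filter (fun x => x ∈ (fun q => A q + t) '' fccStacking 1 (Real.sqrt (2 / 3)) ∧
          (x ∉ (fun q => A q + t) '' barlowStacking 1 (Real.sqrt (2 / 3)) (fun _ : ℤ => (-1 : ℤ)) ∨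
            x ∈ P)),
        ((12 : ℝ) - ((X.filter fun q => dist x q = 1).card : ℝ)) +
      24 * ((P.filter fun x => (ρ - 2) ^ 2 < x 0 ^ 2 + x 1 ^ 2).card : ℝ) := by
  classical
  set e₃ : EuclideanSpace ℝ (Fin 3) := EuclideanSpace.single (2 : Fin 3) (1 : ℝ) with he₃
  -- the reflection `S : (x,y,z) ↦ (x,y,−z)` and the affine mirror `M p = S p + h e₃`
  set S : EuclideanSpace ℝ (Fin 3) ≃ₗᵢ[ℝ] EuclideanSpace ℝ (Fin 3) :=
    ((ℝ ∙ EuclideanSpace.single (2 : Fin 3) (1 : ℝ)).reflection).trans (LinearIsometryEquiv.neg ℝ)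
    with hS
  have hS_apply : ∀ p, S p = -((ℝ ∙ EuclideanSpace.single (2 : Fin 3) (1 : ℝ)).reflection p) := by
    intro p; rfl
  have hS0 : ∀ p : EuclideanSpace ℝ (Fin 3), S p 0 = p 0 := by
    intro p; rw [hS_apply, PiLp.neg_apply, (halfTurn_coord p).1, neg_neg]
  have hS1 : ∀ p : EuclideanSpace ℝ (Fin 3), S p 1 = p 1 := by
    intro p; rw [hS_apply, PiLp.neg_apply, (halfTurn_coord p).2.1, neg_neg]
  have hS2 : ∀ p : EuclideanSpace ℝ (Fin 3), S p 2 = -p 2 := by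
    intro p; rw [hS_apply, PiLp.neg_apply, (halfTurn_coord p).2.2]
  have hSS : ∀ p, S (S p) = p := by
    intro p
    ext l
    fin_cases l
    · simp only [Fin.zero_eta, Fin.isValue]; rw [hS0, hS0]
    · simp only [Fin.mk_one, Fin.isValue]; rw [hS1, hS1]
    · simp only [Fin.reduceFinMk, Fin.isValue]; rw [hS2, hS2, neg_neg]
  set c : EuclideanSpace ℝ (Fin 3) := h • e₃ with hc
  have hc0 : c 0 = 0 := by simp [hc, he₃]
  have hc1 : c 1 = 0 := by simp [hc, he₃]
  have hc2 : c 2 = h := by simp [hc, he₃]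
  let M : EuclideanSpace ℝ (Fin 3) → EuclideanSpace ℝ (Fin 3) := fun p => S p + c
  have hM0 : ∀ p, M p 0 = p 0 := by intro p; simp only [M, PiLp.add_apply, hS0, hc0, add_zero]
  have hM1 : ∀ p, M p 1 = p 1 := by intro p; simp only [M, PiLp.add_apply, hS1, hc1, add_zero]
  have hM2 : ∀ p, M p 2 = h - p 2 := by
    intro p; simp only [M, PiLp.add_apply, hS2, hc2]; ring
  have hMM : ∀ p, M (M p) = p := by
    intro p
    have hSc : S c = -c := by
      ext l; fin_cases l
      · simp only [Fin.zero_eta, Fin.isValue]; rw [hS0, PiLp.neg_apply, hc0, neg_zero]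
      · simp only [Fin.mk_one, Fin.isValue]; rw [hS1, PiLp.neg_apply, hc1, neg_zero]
      · simp only [Fin.reduceFinMk, Fin.isValue]; rw [hS2, PiLp.neg_apply]
    simp only [M, map_add, hSS, hSc]; abel
  have hMinj : Function.Injective M := fun p q hpq => by
    have := congrArg M hpq; rwa [hMM, hMM] at this
  have hMdist : ∀ p q, dist (M p) (M q) = dist p q := by
    intro p q; simp only [M, dist_add_right, LinearIsometryEquiv.dist_map]
  have hMadd : ∀ p w, M (p + w) = M p + S w := by
    intro p w; simp only [M, map_add]; abel
  -- mirrored grains are moved lattices with the reflected frames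
  have hMgrain : ∀ (B : EuclideanSpace ℝ (Fin 3) ≃ₗᵢ[ℝ] EuclideanSpace ℝ (Fin 3)) (s : EuclideanSpace ℝ (Fin 3))
      (D : Set (EuclideanSpace ℝ (Fin 3))),
      M '' ((fun q => B q + s) '' D) = (fun q => (B.trans S) q + M s) '' D := by
    intro B s D
    ext x
    simp only [Set.mem_image, LinearIsometryEquiv.trans_apply]
    constructor
    · rintro ⟨_, ⟨q, hq, rfl⟩, rfl⟩
      exact ⟨q, hq, by simp only [M, map_add]; abel⟩
    · rintro ⟨q, hq, rfl⟩
      exact ⟨B q + s, ⟨q, hq, rfl⟩, by simp only [M, map_add]; abel⟩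
  have hMmem : ∀ (B : EuclideanSpace ℝ (Fin 3) ≃ₗᵢ[ℝ] EuclideanSpace ℝ (Fin 3)) (s p : EuclideanSpace ℝ (Fin 3)),
      M p ∈ (fun q => (B.trans S) q + M s) '' fccStacking 1 (Real.sqrt (2 / 3)) ↔
        p ∈ (fun q => B q + s) '' fccStacking 1 (Real.sqrt (2 / 3)) := by
    intro B s p
    rw [← hMgrain]
    constructor
    · rintro ⟨p', hp', hpp'⟩; rwa [← hMinj hpp']
    · intro hp; exact ⟨p, hp, rfl⟩
  set Λ : Set (EuclideanSpace ℝ (Fin 3)) := (fun q => A q + t) '' fccStacking 1 (Real.sqrt (2 / 3)) with hΛ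
  set Λ' : Set (EuclideanSpace ℝ (Fin 3)) :=
    (fun q => (A.trans S) q + M t) '' fccStacking 1 (Real.sqrt (2 / 3)) with hΛ'
  set Tw : Set (EuclideanSpace ℝ (Fin 3)) :=
    (fun q => A q + t) '' barlowStacking 1 (Real.sqrt (2 / 3)) (fun _ : ℤ => (-1 : ℤ)) with hTw
  set Tw' : Set (EuclideanSpace ℝ (Fin 3)) :=
    (fun q => (A.trans S) q + M t) '' barlowStacking 1 (Real.sqrt (2 / 3)) (fun _ : ℤ => (-1 : ℤ)) with hTw'
  have hMmemTw : ∀ p, M p ∈ Tw' ↔ p ∈ Tw := by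
    intro p
    rw [hTw', ← hMgrain]
    constructor
    · rintro ⟨p', hp', hpp'⟩; rwa [← hMinj hpp']
    · intro hp; exact ⟨p, hp, rfl⟩
  -- the mirrored configuration and slab
  set X' : Finset (EuclideanSpace ℝ (Fin 3)) := X.image M with hX'
  set P' : Finset (EuclideanSpace ℝ (Fin 3)) := P.image M with hP'
  have hmemX' : ∀ p, M p ∈ X' ↔ p ∈ X := by
    intro p
    rw [hX', mem_image]
    constructor
    · rintro ⟨q, hq, hqp⟩; rwa [← hMinj hqp]
    · intro hp; exact ⟨p, hp, rfl⟩
  have hmemP' : ∀ p, M p ∈ P' ↔ p ∈ P := by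
    intro p
    rw [hP', mem_image]
    constructor
    · rintro ⟨q, hq, hqp⟩; rwa [← hMinj hqp]
    · intro hp; exact ⟨p, hp, rfl⟩
  have hX'pack : ∀ p ∈ X', ∀ q ∈ X', p ≠ q → 1 ≤ dist p q := by
    intro p hp q hq hpq
    obtain ⟨p₀, hp₀, rfl⟩ := mem_image.1 hp
    obtain ⟨q₀, hq₀, rfl⟩ := mem_image.1 hq
    rw [hMdist]
    exact hX p₀ hp₀ q₀ hq₀ (fun e => hpq (by rw [e]))
  have hcell' : ∀ p ∈ X', -(2 * R₀) ≤ p 2 ∧ p 2 ≤ h + 2 * R₀ ∧ p 0 ^ 2 + p 1 ^ 2 ≤ ρ ^ 2 := by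
    intro p hp
    obtain ⟨p₀, hp₀, rfl⟩ := mem_image.1 hp
    obtain ⟨h1, h2, h3⟩ := hcell p₀ hp₀
    rw [hM2, hM0, hM1]
    exact ⟨by linarith, by linarith, h3⟩
  have hP'X' : P' ⊆ X' := by
    intro p hp
    obtain ⟨p₀, hp₀, rfl⟩ := mem_image.1 hp
    exact (hmemX' p₀).2 (hPX hp₀)
  have hP'iff : ∀ p, p ∈ P' ↔ (p ∈ Λ' ∧ -(2 * R₀) ≤ p 2 ∧ p 2 ≤ -R₀ ∧ p 0 ^ 2 + p 1 ^ 2 ≤ ρ ^ 2) := by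
    intro p
    have hPM : p ∈ P' ↔ M p ∈ P := by
      have := hmemP' (M p); rwa [hMM] at this
    have hΛM : p ∈ Λ' ↔ M p ∈ Λ := by
      have := hMmem A t (M p); rwa [hMM] at this
    rw [hPM, hΛM, hP (M p), hM2, hM0, hM1]
    constructor
    · rintro ⟨h0, h1, h2, h3⟩; exact ⟨h0, by linarith, by linarith, h3⟩
    · rintro ⟨h0, h1, h2, h3⟩; exact ⟨h0, by linarith, by linarith, h3⟩
  -- degrees are preserved
  have hdegM : ∀ x, (X'.filter fun q => dist (M x) q = 1) = (X.filter fun q => dist x q = 1).image M := by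
    intro x
    ext q
    simp only [mem_filter, mem_image]
    constructor
    · rintro ⟨hq, hd⟩
      obtain ⟨q₀, hq₀, rfl⟩ := mem_image.1 hq
      exact ⟨q₀, ⟨hq₀, by rwa [hMdist] at hd⟩, rfl⟩
    · rintro ⟨q₀, ⟨hq₀, hd⟩, rfl⟩
      exact ⟨(hmemX' q₀).2 hq₀, by rw [hMdist]; exact hd⟩
  have hdegcard : ∀ x, (X'.filter fun q => dist (M x) q = 1).card = (X.filter fun q => dist x q = 1).card := by
    intro x; rw [hdegM, card_image_of_injective _ hMinj]
  -- rigidity is preserved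
  have hrigid' : ∀ p ∈ X', p ∈ Λ' ∨ p ∈ Tw' := by
    intro p hp
    obtain ⟨p₀, hp₀, rfl⟩ := mem_image.1 hp
    rcases hrigid p₀ hp₀ with h1 | h2
    · exact Or.inl ((hMmem A t p₀).2 h1)
    · exact Or.inr ((hMmemTw p₀).2 h2)
  -- apply the bottom-grain lemma to the mirrored cell
  have key := csl_grain_ledger (A.trans S) (M t) X' P' R₀ h ρ hR₀ hρ hX'pack hcell' hP'X' hP'iff hrigid'
  -- the face sum is unchanged
  have hface : ∑ w ∈ fccSlots, |⟪(A.trans S) w, e₃⟫_ℝ| = ∑ w ∈ fccSlots, |⟪A w, e₃⟫_ℝ| := by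
    refine sum_congr rfl fun w _ => ?_
    have e1 : ⟪(A.trans S) w, e₃⟫_ℝ = ((A.trans S) w) 2 := by
      rw [he₃, EuclideanSpace.inner_single_right]; simp
    have e2 : ⟪A w, e₃⟫_ℝ = (A w) 2 := by
      rw [he₃, EuclideanSpace.inner_single_right]; simp
    rw [e1, e2, LinearIsometryEquiv.trans_apply, hS2, abs_neg]
  rw [hface] at key
  -- the sine is unchanged
  have hsine : ⟪(A.trans S) e₃, e₃⟫_ℝ ^ 2 = ⟪A e₃, e₃⟫_ℝ ^ 2 := by
    have e1 : ⟪(A.trans S) e₃, e₃⟫_ℝ = ((A.trans S) e₃) 2 := by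
      rw [he₃, EuclideanSpace.inner_single_right]; simp
    have e2 : ⟪A e₃, e₃⟫_ℝ = (A e₃) 2 := by
      rw [he₃, EuclideanSpace.inner_single_right]; simp
    rw [e1, e2, LinearIsometryEquiv.trans_apply, hS2, neg_sq]
  rw [hsine] at key
  -- the ledger sum is unchanged
  have hsum : ∑ x ∈ X'.filter (fun x => x ∈ Λ' ∧ (x ∉ Tw' ∨ x ∈ P')),
      ((12 : ℝ) - ((X'.filter fun q => dist x q = 1).card : ℝ)) =
      ∑ x ∈ X.filter (fun x => x ∈ Λ ∧ (x ∉ Tw ∨ x ∈ P)),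
        ((12 : ℝ) - ((X.filter fun q => dist x q = 1).card : ℝ)) := by
    have himg : X'.filter (fun x => x ∈ Λ' ∧ (x ∉ Tw' ∨ x ∈ P')) =
        (X.filter fun x => x ∈ Λ ∧ (x ∉ Tw ∨ x ∈ P)).image M := by
      ext x
      simp only [mem_filter, mem_image]
      constructor
      · rintro ⟨hx, hxΛ, hor⟩
        obtain ⟨x₀, hx₀, rfl⟩ := mem_image.1 hx
        refine ⟨x₀, ⟨hx₀, (hMmem A t x₀).1 hxΛ, ?_⟩, rfl⟩
        rcases hor with h1 | h2
        · exact Or.inl (fun h => h1 ((hMmemTw x₀).2 h))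
        · exact Or.inr ((hmemP' x₀).1 h2)
      · rintro ⟨x₀, ⟨hx₀, hxΛ, hor⟩, rfl⟩
        refine ⟨(hmemX' x₀).2 hx₀, (hMmem A t x₀).2 hxΛ, ?_⟩
        rcases hor with h1 | h2
        · exact Or.inl (fun h => h1 ((hMmemTw x₀).1 h))
        · exact Or.inr ((hmemP' x₀).2 h2)
    rw [himg, sum_image (fun x _ y _ hxy => hMinj hxy)]
    refine sum_congr rfl fun x _ => ?_
    rw [hdegcard]
  rw [hsum] at key
  -- the rim balls are unchanged
  have hrim : (P'.filter fun x => (ρ - 2) ^ 2 < x 0 ^ 2 + x 1 ^ 2) =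
      ((P.filter fun x => (ρ - 2) ^ 2 < x 0 ^ 2 + x 1 ^ 2).image M) := by
    ext x
    simp only [mem_filter, mem_image]
    constructor
    · rintro ⟨hx, hr⟩
      obtain ⟨x₀, hx₀, rfl⟩ := mem_image.1 hx
      rw [hM0, hM1] at hr
      exact ⟨x₀, ⟨hx₀, hr⟩, rfl⟩
    · rintro ⟨x₀, ⟨hx₀, hr⟩, rfl⟩
      refine ⟨(hmemP' x₀).2 hx₀, ?_⟩
      rw [hM0, hM1]; exact hr
  rw [hrim, card_image_of_injective _ hMinj] at key
  exact key

end Summit.Ventures.Crystal3D.Theorems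

end
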